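import Mathlib.Analysis.Calculus.FDeriv.Symmetric
import Mathlib.Analysis.Calculus.Deriv.Comp
import Mathlib.Analysis.Calculus.Deriv.Prod
import Mathlib.Analysis.Calculus.ContDiff.RCLike
import HarnessLib

/-!
# Mixed partial derivatives of a two-parameter map commute (`deriv` form of Schwarz's theorem)

Topic `Literature/Analysis/Calculus`. For `Φ : ℝ × ℝ → V` (a one-parameter family of curves, as
the variations `(t, s) ↦ F(t, c(s))` of an evolving immersion along chart-straight curves), the
partial derivatives are values of the Fréchet derivative (`hasDerivAt_curry_left/right`,
`∂ₜΦ = DΦ(1, 0)`, `∂ₛΦ = DΦ(0, 1)`), their derivatives are values of `D²Φ`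
(`hasDerivAt_fderiv_apply_left/right`), and Mathlib's symmetry of `D²Φ` at a `C²` point
(`ContDiffAt.isSymmSndFDerivAt`) gives **`∂ₜ∂ₛΦ(t₀, s₀) = ∂ₛ∂ₜΦ(t₀, s₀)`** in the form used for
evolution equations (`hasDerivAt_deriv_curry_right_of_contDiffAt`: the `t`-derivative of
`t ↦ ∂ₛΦ(t, s₀)` is the `s`-derivative of `s ↦ ∂ₜΦ(t₀, s)`; `hasDerivAt_deriv_curry_right_mixed`,
`hasDerivAt_deriv_curry_left_mixed`: both are the mixed value `D²Φ(q)(1,0)(0,1)`). Everything is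
PROVED; no definitions, no named facts.

## References

* W. Rudin, *Principles of Mathematical Analysis*, 3rd ed., Thm. 9.41 (equality of mixed
  partials); here from Mathlib's `second_derivative_symmetric`. [folklore]
-/

noncomputable section

open Set Filter Function
open scoped Topology

namespace Literature.Analysis.Calculus

variable {V : Type*} [NormedAddCommGroup V] [NormedSpace ℝ V]

/-! ### Partial derivatives of a two-parameter map as values of the Fréchet derivative -/

/-- The partial derivative in the second variable: `∂ₛΦ(t, s) = DΦ(t, s)(0, 1)`. [folklore] -/
theorem hasDerivAt_curry_right {Φ : ℝ × ℝ → V} {q : ℝ × ℝ} (hΦ : DifferentiableAt ℝ Φ q) :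
    HasDerivAt (fun s ↦ Φ (q.1, s)) (fderiv ℝ Φ q ((0 : ℝ), (1 : ℝ))) q.2 := by
  have h := hΦ.hasFDerivAt.comp q.2 (hasFDerivAt_prodMk_right (𝕜 := ℝ) q.1 q.2)
  have h' := h.hasDerivAt
  simp only [ContinuousLinearMap.coe_comp, comp_apply, ContinuousLinearMap.inr_apply] at h'
  exact h'

/-- The partial derivative in the first variable: `∂ₜΦ(t, s) = DΦ(t, s)(1, 0)`. [folklore] -/
theorem hasDerivAt_curry_left {Φ : ℝ × ℝ → V} {q : ℝ × ℝ} (hΦ : DifferentiableAt ℝ Φ q) :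
    HasDerivAt (fun t ↦ Φ (t, q.2)) (fderiv ℝ Φ q ((1 : ℝ), (0 : ℝ))) q.1 := by
  have h := hΦ.hasFDerivAt.comp q.1 (hasFDerivAt_prodMk_left (𝕜 := ℝ) q.1 q.2)
  have h' := h.hasDerivAt
  simp only [ContinuousLinearMap.coe_comp, comp_apply, ContinuousLinearMap.inl_apply] at h'
  exact h'

/-- `deriv` form of `hasDerivAt_curry_right`. [folklore] -/
theorem deriv_curry_right {Φ : ℝ × ℝ → V} {q : ℝ × ℝ} (hΦ : DifferentiableAt ℝ Φ q) :
    deriv (fun s ↦ Φ (q.1, s)) q.2 = fderiv ℝ Φ q ((0 : ℝ), (1 : ℝ)) :=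
  (hasDerivAt_curry_right hΦ).deriv

/-- `deriv` form of `hasDerivAt_curry_left`. [folklore] -/
theorem deriv_curry_left {Φ : ℝ × ℝ → V} {q : ℝ × ℝ} (hΦ : DifferentiableAt ℝ Φ q) :
    deriv (fun t ↦ Φ (t, q.2)) q.1 = fderiv ℝ Φ q ((1 : ℝ), (0 : ℝ)) :=
  (hasDerivAt_curry_left hΦ).deriv

/-! ### Derivatives of the partial derivatives: the mixed second derivatives -/

/-- `d/dt [DΦ(t, s₀) e] = D²Φ(t₀, s₀)(1, 0) e` when `DΦ` is differentiable at `(t₀, s₀)`. [folklore] -/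
theorem hasDerivAt_fderiv_apply_left {Φ : ℝ × ℝ → V} {q : ℝ × ℝ}
    (hΦ : DifferentiableAt ℝ (fderiv ℝ Φ) q) (e : ℝ × ℝ) :
    HasDerivAt (fun t ↦ fderiv ℝ Φ (t, q.2) e) (fderiv ℝ (fderiv ℝ Φ) q ((1 : ℝ), (0 : ℝ)) e) q.1 := by
  have h := (hΦ.hasFDerivAt.comp q.1 (hasFDerivAt_prodMk_left (𝕜 := ℝ) q.1 q.2)).hasDerivAt
  have h' := h.clm_apply (hasDerivAt_const q.1 e)
  simp only [ContinuousLinearMap.coe_comp, comp_apply, ContinuousLinearMap.inl_apply] at h'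
  refine h'.congr_deriv ?_
  rw [map_zero, add_zero]

/-- `d/ds [DΦ(t₀, s) e] = D²Φ(t₀, s₀)(0, 1) e`. [folklore] -/
theorem hasDerivAt_fderiv_apply_right {Φ : ℝ × ℝ → V} {q : ℝ × ℝ}
    (hΦ : DifferentiableAt ℝ (fderiv ℝ Φ) q) (e : ℝ × ℝ) :
    HasDerivAt (fun s ↦ fderiv ℝ Φ (q.1, s) e) (fderiv ℝ (fderiv ℝ Φ) q ((0 : ℝ), (1 : ℝ)) e) q.2 := by
  have h := (hΦ.hasFDerivAt.comp q.2 (hasFDerivAt_prodMk_right (𝕜 := ℝ) q.1 q.2)).hasDerivAt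
  have h' := h.clm_apply (hasDerivAt_const q.2 e)
  simp only [ContinuousLinearMap.coe_comp, comp_apply, ContinuousLinearMap.inr_apply] at h'
  refine h'.congr_deriv ?_
  rw [map_zero, add_zero]

/-! ### Mixed partial derivatives commute -/

/-- **Schwarz's theorem for a two-parameter map, in `deriv` form.** If `Φ : ℝ × ℝ → V` is `C²`
at `q = (t₀, s₀)`, then the `t`-derivative at `t₀` of the partial derivative
`t ↦ ∂ₛΦ(t, s₀)` equals the `s`-derivative at `s₀` of `s ↦ ∂ₜΦ(t₀, s)`:
`∂ₜ∂ₛΦ(t₀, s₀) = ∂ₛ∂ₜΦ(t₀, s₀)`, both partial derivatives existing near `q`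
(Mathlib's symmetry of the second Fréchet derivative, `ContDiffAt.isSymmSndFDerivAt`). [folklore] -/
theorem hasDerivAt_deriv_curry_right_of_contDiffAt {Φ : ℝ × ℝ → V} {q : ℝ × ℝ}
    (hΦ : ContDiffAt ℝ 2 Φ q) :
    HasDerivAt (fun t ↦ deriv (fun s ↦ Φ (t, s)) q.2)
      (deriv (fun s ↦ deriv (fun t ↦ Φ (t, s)) q.1) q.2) q.1 := by
  -- `Φ` is differentiable near `q`, `DΦ` is differentiable at `q`
  have hdiff : ∀ᶠ q' in 𝓝 q, DifferentiableAt ℝ Φ q' := by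
    have h := hΦ.eventually (by simp)
    exact h.mono fun q' hq' ↦ hq'.differentiableAt (by simp)
  have hD : DifferentiableAt ℝ (fderiv ℝ Φ) q :=
    (hΦ.fderiv_right (m := 1) le_rfl).differentiableAt (by simp)
  have hsymm : fderiv ℝ (fderiv ℝ Φ) q ((1 : ℝ), (0 : ℝ)) ((0 : ℝ), (1 : ℝ)) =
      fderiv ℝ (fderiv ℝ Φ) q ((0 : ℝ), (1 : ℝ)) ((1 : ℝ), (0 : ℝ)) :=
    hΦ.isSymmSndFDerivAt (by simp) _ _
  -- the partial derivatives near `q` are values of `DΦ`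
  obtain ⟨t₀, s₀⟩ := q
  have hright : (fun t ↦ deriv (fun s ↦ Φ (t, s)) s₀) =ᶠ[𝓝 t₀]
      fun t ↦ fderiv ℝ Φ (t, s₀) ((0 : ℝ), (1 : ℝ)) := by
    have h := (Continuous.prodMk_left s₀).continuousAt.eventually hdiff
    exact h.mono fun t (ht : DifferentiableAt ℝ Φ (t, s₀)) ↦ deriv_curry_right (q := (t, s₀)) ht
  have hleft : (fun s ↦ deriv (fun t ↦ Φ (t, s)) t₀) =ᶠ[𝓝 s₀]
      fun s ↦ fderiv ℝ Φ (t₀, s) ((1 : ℝ), (0 : ℝ)) := by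
    have h := (Continuous.prodMk_right t₀).continuousAt.eventually hdiff
    exact h.mono fun s (hs : DifferentiableAt ℝ Φ (t₀, s)) ↦ deriv_curry_left (q := (t₀, s)) hs
  have h1 := (hasDerivAt_fderiv_apply_left (q := (t₀, s₀)) hD ((0 : ℝ), (1 : ℝ))).congr_of_eventuallyEq hright
  have h2 := (hasDerivAt_fderiv_apply_right (q := (t₀, s₀)) hD ((1 : ℝ), (0 : ℝ))).congr_of_eventuallyEq hleft
  show HasDerivAt (fun t ↦ deriv (fun s ↦ Φ (t, s)) s₀)
    (deriv (fun s ↦ deriv (fun t ↦ Φ (t, s)) t₀) s₀) t₀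
  rw [h2.deriv, ← hsymm]
  exact h1


/-- **The `t`-derivative of `∂ₛΦ`** at a `C²` point: `d/dt|_{t₀} ∂ₛΦ(t, s₀) = D²Φ(q)(1,0)(0,1)`.
[folklore] -/
theorem hasDerivAt_deriv_curry_right_mixed {Φ : ℝ × ℝ → V} {q : ℝ × ℝ} (hΦ : ContDiffAt ℝ 2 Φ q) :
    HasDerivAt (fun t ↦ deriv (fun s ↦ Φ (t, s)) q.2)
      (fderiv ℝ (fderiv ℝ Φ) q ((1 : ℝ), (0 : ℝ)) ((0 : ℝ), (1 : ℝ))) q.1 := by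
  have hdiff : ∀ᶠ q' in 𝓝 q, DifferentiableAt ℝ Φ q' := by
    have h := hΦ.eventually (by simp)
    exact h.mono fun q' hq' ↦ hq'.differentiableAt (by simp)
  have hD : DifferentiableAt ℝ (fderiv ℝ Φ) q :=
    (hΦ.fderiv_right (m := 1) le_rfl).differentiableAt (by simp)
  obtain ⟨t₀, s₀⟩ := q
  have hright : (fun t ↦ deriv (fun s ↦ Φ (t, s)) s₀) =ᶠ[𝓝 t₀]
      fun t ↦ fderiv ℝ Φ (t, s₀) ((0 : ℝ), (1 : ℝ)) := by
    have h := (Continuous.prodMk_left s₀).continuousAt.eventually hdiff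
    exact h.mono fun t (ht : DifferentiableAt ℝ Φ (t, s₀)) ↦ deriv_curry_right (q := (t, s₀)) ht
  exact (hasDerivAt_fderiv_apply_left (q := (t₀, s₀)) hD ((0 : ℝ), (1 : ℝ))).congr_of_eventuallyEq hright

/-- **The `s`-derivative of `∂ₜΦ`** at a `C²` point is the SAME mixed value:
`d/ds|_{s₀} ∂ₜΦ(t₀, s) = D²Φ(q)(1,0)(0,1)` (by the symmetry of `D²Φ`). [folklore] -/
theorem hasDerivAt_deriv_curry_left_mixed {Φ : ℝ × ℝ → V} {q : ℝ × ℝ} (hΦ : ContDiffAt ℝ 2 Φ q) :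
    HasDerivAt (fun s ↦ deriv (fun t ↦ Φ (t, s)) q.1)
      (fderiv ℝ (fderiv ℝ Φ) q ((1 : ℝ), (0 : ℝ)) ((0 : ℝ), (1 : ℝ))) q.2 := by
  have hdiff : ∀ᶠ q' in 𝓝 q, DifferentiableAt ℝ Φ q' := by
    have h := hΦ.eventually (by simp)
    exact h.mono fun q' hq' ↦ hq'.differentiableAt (by simp)
  have hD : DifferentiableAt ℝ (fderiv ℝ Φ) q :=
    (hΦ.fderiv_right (m := 1) le_rfl).differentiableAt (by simp)
  have hsymm : fderiv ℝ (fderiv ℝ Φ) q ((1 : ℝ), (0 : ℝ)) ((0 : ℝ), (1 : ℝ)) =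
      fderiv ℝ (fderiv ℝ Φ) q ((0 : ℝ), (1 : ℝ)) ((1 : ℝ), (0 : ℝ)) :=
    hΦ.isSymmSndFDerivAt (by simp) _ _
  obtain ⟨t₀, s₀⟩ := q
  have hleft : (fun s ↦ deriv (fun t ↦ Φ (t, s)) t₀) =ᶠ[𝓝 s₀]
      fun s ↦ fderiv ℝ Φ (t₀, s) ((1 : ℝ), (0 : ℝ)) := by
    have h := (Continuous.prodMk_right t₀).continuousAt.eventually hdiff
    exact h.mono fun s (hs : DifferentiableAt ℝ Φ (t₀, s)) ↦ deriv_curry_left (q := (t₀, s)) hs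
  rw [hsymm]
  exact (hasDerivAt_fderiv_apply_right (q := (t₀, s₀)) hD ((1 : ℝ), (0 : ℝ))).congr_of_eventuallyEq hleft

end Literature.Analysis.Calculus

end
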